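import Summits.CriticalPhenomena.PercolationContinuityZ3.Theorems.Transplant.Slab111HubU19Rules
import HarnessLib

/-!
# The HUB ROUTING of the `(111)`-films, XXII: GENERIC SHAPES — cleared sets given by column predicates, their facts and terminal rules

builds on p205010 (kernel theorem, internal audit signed; external expert review pending) — NOT used in this file.  Lane `prim-bschramm`, seat
`prim-bschramm-p2` (gen 36; class C1b; memo `HOME/bschramm/P2-LATTICES.md` §131); helper file (`--supports stmt-CriticalPhenomena-4575 --as helper`).
The remaining block types of «HexShadowVRouteData».`ShapedLinkage 3` (clipped in one direction) use the hub at the block centre `z` and a cleared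
set described by Boolean column predicates (§1, `ShapeB`, `WOf`): columns `colsB` (relative to `z`), minus the columns `badBot` at level `0` and
`badTop` at level `k`.  §2: the facts the assembly needs (containment in the block from `colsD`, the forced vertices from `forced`, bulk / boundary
membership, non-members).  §3: GENERIC TERMINAL RULES straight from `Terminals.nbrs` — an `E`-terminal has an EXIT (a neighbour over a column
outside `colsB` or a bad boundary vertex, inside the window `inwinB`) (`ruleXG`), a boundary-level `E`-terminal has an exit and a second window
neighbour off `w'`'s column that is not the other terminal (`ruleR2G`), flag `0` only off the bad columns — with soundness; §4 the membership of
the low leg vertices (`low_memG`).  The unclipped shape «Slab111HubU19Rules» is the instance `colsB = (tnZ ≤ 2)`, `bad = cornerB`.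
[cite: DuminilCopinSidoraviciusTassion2016, §2.3 (proof of Fact 2: the three disjoint paths γ_u, γ_v, γ_w in B_R(z))]
-/

noncomputable section

namespace Summit.CriticalPhenomena.PercolationContinuityZ3.Theorems.Transplant

open Literature.Probability.Percolation Literature.Probability.LatticeModels SimpleGraph
open scoped Classical

namespace Slab111

variable {k : ℕ}

/-! ## §1 Shapes and their cleared sets -/

/-- **A shape**: Boolean column predicates relative to the block centre — cleared columns, bad columns on the bottom / top boundary level,
the window of admissible exits, the rerouting-region columns — and an enumeration of the cleared columns for the table checker. [folklore] -/
structure ShapeB where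
  /-- cleared columns -/
  colsB : ℤ × ℤ → Bool
  /-- columns missing at level `0` -/
  badBot : ℤ × ℤ → Bool
  /-- columns missing at level `k` -/
  badTop : ℤ × ℤ → Bool
  /-- the window `InWin` of the block, as a predicate on relative columns -/
  inwinB : ℤ × ℤ → Bool
  /-- rerouting-region columns (cleared and inside the rerouting block) -/
  pcB : ℤ × ℤ → Bool
  /-- the cleared columns as a list -/
  cols : List (ℤ × ℤ)

/-- The bad columns behind a terminal of side `d`. [folklore] -/
def ShapeB.badG (S : ShapeB) (d : ℤ) : ℤ × ℤ → Bool := if d = 1 then S.badBot else S.badTop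

/-- **The cleared set of a shape** at centre `z`. [folklore] -/
def WOf (S : ShapeB) (k : ℕ) (z : Site 2) : Set (slab111 k) :=
  {x | S.colsB (relC z x) = true ∧ ¬ (lev (x : Site 3) = 0 ∧ S.badBot (relC z x) = true) ∧ ¬ (lev (x : Site 3) = k ∧ S.badTop (relC z x) = true)}

/-- Block membership of a relative column, as the Boolean `inBlkB`. [folklore] -/
theorem mem_blkR_vcol_iff (z : Site 2) (t s : ℕ) (q : ℤ × ℤ) : vcol z q ∈ blkR 3 z t s ↔ inBlkB t s q = true := by
  unfold inBlkB
  simp only [mem_blkR, mem_hexBall, Bool.and_eq_true, decide_eq_true_eq, tnZ, triNorm, Pi.sub_apply, vcol_apply_zero, vcol_apply_one,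
    add_sub_cancel_left]
  constructor
  · rintro ⟨h1, h2, h3⟩; exact ⟨⟨by exact_mod_cast h1, by omega⟩, by omega⟩
  · rintro ⟨⟨h1, h2⟩, h3⟩; exact ⟨by exact_mod_cast h1, by omega, by omega⟩

/-- `sh x ∈ blkR` in terms of the relative column. [folklore] -/
theorem sh_mem_blkR_iff (z : Site 2) (t s : ℕ) (x : slab111 k) : sh x ∈ blkR 3 z t s ↔ inBlkB t s (relC z x) = true := by
  rw [sh_eq_vcol_relC z x]; exact mem_blkR_vcol_iff z t s _

/-- **Validity of a shape for a block type** `(t_R, t_D, s_R, s_D)`: cleared columns inside the big block, forced vertices cleared and never bad,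
region columns = cleared ∩ rerouting block, real window ⊆ `inwinB`, the list enumerates the cleared columns. [folklore] -/
structure ShapeB.Valid (S : ShapeB) (tR tD sR sD : ℕ) : Prop where
  colsD : ∀ q, S.colsB q = true → inBlkB tD sD q = true
  forced : ∀ q, tnZ q ≤ 1 → inBlkB tD sD q = true → S.colsB q = true ∧ S.badBot q = false ∧ S.badTop q = false
  pcR : ∀ q, S.pcB q = true ↔ S.colsB q = true ∧ inBlkB tR sR q = true
  inwin : ∀ q : ℤ × ℤ, q.1 ≤ tD → q.1 + q.2 ≤ sR → S.inwinB q = true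
  colsList : ∀ q, S.colsB q = true → q ∈ S.cols

/-! ## §2 Facts about the cleared set -/

/-- `W ⊆ lift blk_D`. [folklore] -/
theorem WOf_subset_blkR {S : ShapeB} {tR tD sR sD : ℕ} (hV : S.Valid tR tD sR sD) (z : Site 2) :
    ∀ x ∈ WOf S k z, (hexShadow k).sh x ∈ blkR 3 z tD sD := fun x hx => by
  rw [hexShadow_sh, sh_mem_blkR_iff]; exact hV.colsD _ hx.1

/-- The forced vertices are cleared. [folklore] -/
theorem mem_WOf_of_hexBall_one {S : ShapeB} {tR tD sR sD : ℕ} (hV : S.Valid tR tD sR sD) (z : Site 2) (x : slab111 k)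
    (h1 : (hexShadow k).sh x ∈ hexBall z 1) (hD : (hexShadow k).sh x ∈ blkR 3 z tD sD) : x ∈ WOf S k z := by
  rw [hexShadow_sh] at h1 hD
  rw [sh_mem_blkR_iff] at hD
  have ht : tnZ (relC z x) ≤ 1 := by
    rw [tnZ_relC]; simp only [mem_hexBall] at h1; exact_mod_cast h1
  obtain ⟨hc, hb, ht'⟩ := hV.forced _ ht hD
  exact ⟨hc, fun ⟨_, h⟩ => by rw [hb] at h; exact Bool.false_ne_true h, fun ⟨_, h⟩ => by rw [ht'] at h; exact Bool.false_ne_true h⟩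

/-- **Bulk membership** over a cleared column. [folklore] -/
theorem vl_mem_WOf {S : ShapeB} {z : Site 2} {c0 : ℤ} (hz : (3 : ℤ) ∣ z 0 + 2 * z 1 - c0) {q : ℤ × ℤ} (hq : S.colsB q = true) {L : ℤ}
    (h1 : 1 ≤ L) (hk : L ≤ (k : ℤ) - 1) (hd : (3 : ℤ) ∣ L - c0 - (q.1 + 2 * q.2)) : vl k (vcol z q) L ∈ WOf S k z := by
  have hadm := adm_vcol (k := k) hz (by omega) (by omega) hd
  refine ⟨by rw [relC_vl hadm]; exact hq, ?_, ?_⟩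
  · rintro ⟨h0, -⟩; rw [lev_vl hadm] at h0; omega
  · rintro ⟨hK, -⟩; rw [lev_vl hadm] at hK; omega

/-- **Any-level membership** over a cleared column that is not bad on the relevant boundary. [folklore] -/
theorem vl_mem_WOf_any {S : ShapeB} {z : Site 2} {c0 : ℤ} (hz : (3 : ℤ) ∣ z 0 + 2 * z 1 - c0) {q : ℤ × ℤ} (hq : S.colsB q = true) {L : ℤ}
    (h0 : 0 ≤ L) (hk : L ≤ (k : ℤ)) (hb : L = 0 → S.badBot q = false) (ht : L = k → S.badTop q = false)
    (hd : (3 : ℤ) ∣ L - c0 - (q.1 + 2 * q.2)) : vl k (vcol z q) L ∈ WOf S k z := by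
  have hadm := adm_vcol (k := k) hz h0 hk hd
  refine ⟨by rw [relC_vl hadm]; exact hq, ?_, ?_⟩
  · rintro ⟨hL, hbad⟩; rw [lev_vl hadm] at hL; rw [relC_vl hadm, hb hL] at hbad; exact Bool.false_ne_true hbad
  · rintro ⟨hL, hbad⟩; rw [lev_vl hadm] at hL; rw [relC_vl hadm, ht hL] at hbad; exact Bool.false_ne_true hbad

/-- Region membership: a member of `W` over the rerouting block is in `PR = W ∩ lift blk_R`. [folklore] -/
theorem mem_PR_of {S : ShapeB} {z : Site 2} {tR sR : ℕ} {x : slab111 k} (hx : x ∈ WOf S k z) (hR : inBlkB tR sR (relC z x) = true) :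
    x ∈ WOf S k z ∩ (hexShadow k).lift (blkR 3 z tR sR) :=
  ⟨hx, by rw [HexShadow.mem_lift, hexShadow_sh, sh_mem_blkR_iff]; exact hR⟩

/-- **The facts about a member** the dispatcher uses. [folklore] -/
theorem member_factsG {S : ShapeB} {z : Site 2} {x : slab111 k} (hx : x ∈ WOf S k z) :
    S.colsB (relC z x) = true ∧ sh x = vcol z (relC z x) ∧ 0 ≤ lev (x : Site 3) ∧ lev (x : Site 3) ≤ k :=
  ⟨hx.1, sh_eq_vcol_relC z x, (mem_slab111_iff_lev.1 x.2).1, (mem_slab111_iff_lev.1 x.2).2⟩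

/-- **A non-member** near the shape: its column is not cleared, or it is a bad boundary vertex. [folklore] -/
theorem not_mem_WOf {S : ShapeB} {z : Site 2} {y : slab111 k} (h : y ∉ WOf S k z) :
    S.colsB (relC z y) = false ∨ (lev (y : Site 3) = 0 ∧ S.badBot (relC z y) = true) ∨ (lev (y : Site 3) = k ∧ S.badTop (relC z y) = true) := by
  by_cases hc : S.colsB (relC z y) = true
  · right; by_contra hn
    apply h; refine ⟨hc, fun hb => hn (Or.inl hb), fun ht => hn (Or.inr ht)⟩
  · left; simpa using hc

/-! ## §3 Generic terminal rules -/

/-- The boundary status of the neighbour level `n + s` of a terminal with side `d`, flag `β`, for the step `s = ±1`: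
`0` bulk, `1` bottom level, `2` top level, `3` does not exist. [folklore] -/
def nbStatus (d : ℤ) (β : ℕ) (s : ℤ) : ℕ :=
  if d = 1 then (if β = 0 then (if s = 1 then 0 else 3) else if β = 1 then (if s = 1 then 0 else 1) else 0)
  else (if β = 0 then (if s = -1 then 0 else 3) else if β = 1 then (if s = -1 then 0 else 2) else 0)

/-- **An exit column**: a neighbour over column `c` at a level of status `st` is outside the cleared set (not a cleared column, or bad on its
boundary level) and inside the window. [folklore] -/
def ShapeB.exitB (S : ShapeB) (c : ℤ × ℤ) (st : ℕ) : Bool :=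
  !(st == 3) && S.inwinB c && (!S.colsB c || ((st == 1) && S.badBot c) || ((st == 2) && S.badTop c))

/-- **Generic rule X**: an `E`-terminal (column `q`, side `d`, flag `β`) has an exit among its six neighbours. [folklore] -/
def ShapeB.ruleXG (S : ShapeB) (q : ℤ × ℤ) (d : ℤ) (β : ℕ) : Bool :=
  UPS.any fun u => S.exitB (q.1 + u.1, q.2 + u.2) (nbStatus d β 1) || S.exitB (q.1 - u.1, q.2 - u.2) (nbStatus d β (-1))

/-- **Generic rule R2**: an `E`-terminal ON its boundary level (flag `0`) has, among its three inward neighbours, an exit `o` and another window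
column `a ≠ o`, off `w'`'s column, not the other `E`-terminal. [folklore] -/
def ShapeB.ruleR2G (S : ShapeB) (qi qj q₃ : ℤ × ℤ) (di dj : ℤ) (βi βj : ℕ) : Bool :=
  !(βi == 0) ||
    (UPS.map fun u => (qi.1 + di * u.1, qi.2 + di * u.2)).any fun co => S.exitB co 0 &&
      (UPS.map fun u => (qi.1 + di * u.1, qi.2 + di * u.2)).any fun ca =>
        (ca != co) && S.inwinB ca && (ca != q₃) && !((ca == qj) && (dj == di) && (βj == 1))

/-- **The generic flag filter**: flag `0` only off the bad columns of that boundary, rule X for both `E`-terminals, rule R2 both ways. [folklore] -/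
def ShapeB.filtG (S : ShapeB) (q₁ q₂ q₃ : ℤ × ℤ) (d₁ d₂ d₃ : ℤ) (β₁ β₂ β₃ : ℕ) : Bool :=
  !((β₁ == 0) && S.badG d₁ q₁) && !((β₂ == 0) && S.badG d₂ q₂) && !((β₃ == 0) && S.badG d₃ q₃) &&
    S.ruleXG q₁ d₁ β₁ && S.ruleXG q₂ d₂ β₂ && S.ruleR2G q₁ q₂ q₃ d₁ d₂ β₁ β₂ && S.ruleR2G q₂ q₁ q₃ d₂ d₁ β₂ β₁

/-- The flag-`0` rule: a member on a boundary level is not over a bad column of that boundary. [folklore] -/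
theorem badG_of_flag {S : ShapeB} {z : Site 2} {Hlo : ℤ} {x : slab111 k} (hx : x ∈ WOf S k z)
    (hβ : βOf k (dirOfLevel 3 Hlo (lev (x : Site 3))) (lev (x : Site 3)) = 0) :
    S.badG (dirOfLevel 3 Hlo (lev (x : Site 3))) (relC z x) = false := by
  have hlev := (mem_slab111_iff_lev.1 x.2)
  have hd := dirOfLevel_eq 3 Hlo (lev (x : Site 3))
  have hs := βOf_spec (k := k) hd hlev.1 hlev.2
  have hdist := hs.2.1.1 hβ
  unfold ShapeB.badG
  rcases hd with e | e <;> rw [e] at hdist ⊢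
  · simp only [↓reduceIte] at hdist ⊢
    rw [Bool.eq_false_iff]; exact fun hb => hx.2.1 ⟨hdist, hb⟩
  · simp only [show ¬ ((-1 : ℤ) = 1) by norm_num, ↓reduceIte] at hdist ⊢
    rw [Bool.eq_false_iff]; exact fun hb => hx.2.2 ⟨by omega, hb⟩

/-- An exit vertex gives `exitB` at its column with the right status. [folklore] -/
theorem exitB_of_not_mem {S : ShapeB} {tR tD sR sD : ℕ} (hV : S.Valid tR tD sR sD) {z : Site 2} {o : slab111 k} (ho : o ∉ WOf S k z)
    (hwin : HexShadow.InWin z tD sR ((hexShadow k).sh o)) {st : ℕ} (hst : st ≠ 3) (h0 : lev (o : Site 3) = 0 → st = 1)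
    (hk : lev (o : Site 3) = k → st = 2) : S.exitB (relC z o) st = true := by
  have hw : S.inwinB (relC z o) = true := by
    rw [hexShadow_sh] at hwin
    unfold HexShadow.InWin at hwin
    rw [sh_eq_vcol_relC z o] at hwin
    simp only [vcol_apply_zero, vcol_apply_one] at hwin
    exact hV.inwin _ (by omega) (by omega)
  unfold ShapeB.exitB
  rw [Bool.and_eq_true, Bool.and_eq_true]
  refine ⟨⟨by simpa using hst, hw⟩, ?_⟩
  rw [Bool.or_eq_true, Bool.or_eq_true]
  rcases not_mem_WOf ho with hc | ⟨hl, hb⟩ | ⟨hl, hb⟩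
  · left; left; simpa using hc
  · left; right; rw [h0 hl]; simpa using hb
  · right; rw [hk hl]; simpa using hb

/-- **RULE X from `Terminals`** (generic): an `E`-terminal in `W` clearing the zone with a neighbour `o ∉ W` inside the window. [folklore] -/
theorem ruleXG_of_terminal {S : ShapeB} {tR tD sR sD : ℕ} (hV : S.Valid tR tD sR sD) {z : Site 2} {Hlo : ℤ} (hH2 : 2 ≤ Hlo)
    (hHk : Hlo + 3 ≤ (k : ℤ) - 2) {E o : slab111 k} (hc : Clears 3 Hlo (lev (E : Site 3))) (ho : o ∉ WOf S k z)
    (hwin : HexShadow.InWin z tD sR ((hexShadow k).sh o)) (hadj : (film k).Adj E o) :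
    S.ruleXG (relC z E) (dirOfLevel 3 Hlo (lev (E : Site 3))) (βOf k (dirOfLevel 3 Hlo (lev (E : Site 3))) (lev (E : Site 3))) = true := by
  have hlevE := (mem_slab111_iff_lev.1 E.2)
  have hlevo := (mem_slab111_iff_lev.1 o.2)
  have hd := dirOfLevel_eq 3 Hlo (lev (E : Site 3))
  have hm := dir_margin hc
  obtain ⟨u, hu, hn⟩ := nbr_relC (z := z) hadj
  unfold ShapeB.ruleXG
  rw [List.any_eq_true]
  refine ⟨u, hu, ?_⟩
  rw [Bool.or_eq_true]
  rcases hn with ⟨hcol, hl⟩ | ⟨hcol, hl⟩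
  · left
    have hcol' : relC z o = ((relC z E).1 + u.1, (relC z E).2 + u.2) := hcol
    rw [← hcol']
    rcases hd with e | e <;> rw [e] at hm ⊢
    · rcases βOf_cases (k := k) (d := 1) (n := lev (E : Site 3)) (Or.inl rfl) hlevE.1 hlevE.2 with ⟨hdist, hb⟩ | ⟨hdist, hb⟩ | ⟨hdist, hb⟩ <;>
        simp only [↓reduceIte] at hdist <;> rw [hb] <;>
        (refine exitB_of_not_mem hV ho hwin (by decide) (fun h => ?_) (fun h => ?_) <;> first | decide | (exfalso; omega))
    · rcases βOf_cases (k := k) (d := -1) (n := lev (E : Site 3)) (Or.inr rfl) hlevE.1 hlevE.2 with ⟨hdist, hb⟩ | ⟨hdist, hb⟩ | ⟨hdist, hb⟩ <;>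
        simp only [show ¬ ((-1 : ℤ) = 1) by norm_num, ↓reduceIte] at hdist <;> rw [hb] <;>
        first
          | (exfalso; omega)
          | (refine exitB_of_not_mem hV ho hwin (by decide) (fun h => ?_) (fun h => ?_) <;> first | decide | (exfalso; omega))
  · right
    have hcol' : relC z o = ((relC z E).1 - u.1, (relC z E).2 - u.2) := hcol
    rw [← hcol']
    rcases hd with e | e <;> rw [e] at hm ⊢
    · rcases βOf_cases (k := k) (d := 1) (n := lev (E : Site 3)) (Or.inl rfl) hlevE.1 hlevE.2 with ⟨hdist, hb⟩ | ⟨hdist, hb⟩ | ⟨hdist, hb⟩ <;>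
        simp only [↓reduceIte] at hdist <;> rw [hb] <;>
        first
          | (exfalso; omega)
          | (refine exitB_of_not_mem hV ho hwin (by decide) (fun h => ?_) (fun h => ?_) <;> first | decide | (exfalso; omega))
    · rcases βOf_cases (k := k) (d := -1) (n := lev (E : Site 3)) (Or.inr rfl) hlevE.1 hlevE.2 with ⟨hdist, hb⟩ | ⟨hdist, hb⟩ | ⟨hdist, hb⟩ <;>
        simp only [show ¬ ((-1 : ℤ) = 1) by norm_num, ↓reduceIte] at hdist <;> rw [hb] <;>
        (refine exitB_of_not_mem hV ho hwin (by decide) (fun h => ?_) (fun h => ?_) <;> first | decide | (exfalso; omega))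

/-- **RULE R2 from `Terminals`** (generic) for an `E`-terminal on its boundary level. [folklore] -/
theorem ruleR2G_of_terminal {S : ShapeB} {tR tD sR sD : ℕ} (hV : S.Valid tR tD sR sD) {z : Site 2} {Hlo : ℤ} (hk3 : 3 ≤ (k : ℤ))
    {E E' w' o a : slab111 k} (hβ : βOf k (dirOfLevel 3 Hlo (lev (E : Site 3))) (lev (E : Site 3)) = 0) (ho : o ∉ WOf S k z)
    (howin : HexShadow.InWin z tD sR ((hexShadow k).sh o)) (hawin : HexShadow.InWin z tD sR ((hexShadow k).sh a))
    (hoE : (film k).Adj o E) (hEa : (film k).Adj E a) (hao : a ≠ o) (haE' : a ≠ E') (haw : sh a ≠ sh w') {d' : ℤ} (hd' : d' = 1 ∨ d' = -1)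
    (hn' : 0 ≤ lev (E' : Site 3) ∧ lev (E' : Site 3) ≤ k) :
    S.ruleR2G (relC z E) (relC z E') (relC z w') (dirOfLevel 3 Hlo (lev (E : Site 3))) d'
      (βOf k (dirOfLevel 3 Hlo (lev (E : Site 3))) (lev (E : Site 3))) (βOf k d' (lev (E' : Site 3))) = true := by
  have hlevE := (mem_slab111_iff_lev.1 E.2)
  have hlevo := (mem_slab111_iff_lev.1 o.2)
  have hleva := (mem_slab111_iff_lev.1 a.2)
  have hdE := dirOfLevel_eq 3 Hlo (lev (E : Site 3))
  set d := dirOfLevel 3 Hlo (lev (E : Site 3)) with hdd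
  have hsE := βOf_spec (k := k) hdE hlevE.1 hlevE.2
  have hdist := (hsE.2.1.1 hβ)
  obtain ⟨uo, huo, hno⟩ := nbr_relC (z := z) hoE.symm
  obtain ⟨ua, hua, hna⟩ := nbr_relC (z := z) hEa
  have hs' := βOf_spec (k := k) hd' hn'.1 hn'.2
  have key : ∀ {y : slab111 k} {u : ℤ × ℤ}, 0 ≤ lev (y : Site 3) → lev (y : Site 3) ≤ k →
      ((relC z y = ((relC z E).1 + u.1, (relC z E).2 + u.2) ∧ lev (y : Site 3) = lev (E : Site 3) + 1) ∨
        (relC z y = ((relC z E).1 - u.1, (relC z E).2 - u.2) ∧ lev (y : Site 3) = lev (E : Site 3) - 1)) →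
      relC z y = ((relC z E).1 + d * u.1, (relC z E).2 + d * u.2) ∧ lev (y : Site 3) = lev (E : Site 3) + d := by
    intro y u hy0 hyk hy
    rcases hdE with e | e <;> rw [e] at hdist ⊢
    · simp only [↓reduceIte] at hdist
      rcases hy with ⟨hc, hl⟩ | ⟨hc, hl⟩
      · exact ⟨by rw [hc]; simp, by omega⟩
      · omega
    · simp only [show ¬ ((-1 : ℤ) = 1) by norm_num, ↓reduceIte] at hdist
      rcases hy with ⟨hc, hl⟩ | ⟨hc, hl⟩
      · omega
      · exact ⟨by rw [hc]; ext <;> simp <;> ring, by omega⟩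
  obtain ⟨hco, hlo⟩ := key hlevo.1 hlevo.2 hno
  obtain ⟨hca, hla⟩ := key hleva.1 hleva.2 hna
  -- `o` is an exit at a bulk level
  have hobulk : lev (o : Site 3) ≠ 0 ∧ lev (o : Site 3) ≠ k := by
    rcases hdE with e | e <;> rw [e] at hdist hlo
    · simp only [↓reduceIte] at hdist; constructor <;> omega
    · simp only [show ¬ ((-1 : ℤ) = 1) by norm_num, ↓reduceIte] at hdist; constructor <;> omega
  have hox : S.exitB (relC z o) 0 = true := exitB_of_not_mem hV ho howin (by norm_num) (fun h => absurd h hobulk.1) (fun h => absurd h hobulk.2)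
  have haw' : S.inwinB (relC z a) = true := by
    rw [hexShadow_sh] at hawin; unfold HexShadow.InWin at hawin; rw [sh_eq_vcol_relC z a] at hawin
    simp only [vcol_apply_zero, vcol_apply_one] at hawin; exact hV.inwin _ (by omega) (by omega)
  unfold ShapeB.ruleR2G
  rw [hβ]
  simp only [beq_self_eq_true, Bool.not_true, Bool.false_or]
  rw [List.any_eq_true]
  refine ⟨relC z o, List.mem_map.2 ⟨uo, huo, hco.symm⟩, ?_⟩
  rw [Bool.and_eq_true, List.any_eq_true]
  refine ⟨hox, relC z a, List.mem_map.2 ⟨ua, hua, hca.symm⟩, ?_⟩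
  rw [Bool.and_eq_true, Bool.and_eq_true, Bool.and_eq_true, bne_iff_ne, bne_iff_ne]
  refine ⟨⟨⟨relC_ne_of_ne hao (by rw [hla, hlo]), haw'⟩, relC_ne_of_sh_ne haw⟩, notAnd3 fun ⟨hcq, hdd', hb1⟩ => ?_⟩
  rw [beq_iff_eq] at hcq hdd' hb1
  apply haE'
  apply eq_of_sh_eq_of_lev_eq (by rw [sh_eq_vcol_relC z a, sh_eq_vcol_relC z E', hcq])
  have := hs'.2.2.1.1 hb1
  rw [hdd'] at this
  rcases hdE with e | e <;> rw [e] at hdist this hla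
  · simp only [↓reduceIte] at hdist this; omega
  · simp only [show ¬ ((-1 : ℤ) = 1) by norm_num, ↓reduceIte] at hdist this; omega

/-! ## §4 Membership of the low leg vertices -/

/-- **LOW-VERTEX MEMBERSHIP** (generic): for a leg over cleared columns accepted by `accB` with the bad columns of the terminal's side, every
non-terminal vertex at `d·Δℓ ≤ 0` is a film vertex of `W`. [folklore] -/
theorem low_memG {S : ShapeB} {z : Site 2} {c0 Hlo : ℤ} (hz : (3 : ℤ) ∣ z 0 + 2 * z 1 - c0) (hH2 : 2 ≤ Hlo) (hHk : Hlo + 3 ≤ (k : ℤ) - 2)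
    {l : List MV} {q : ℤ × ℤ} {F : FaceD} {C : List (ℤ × ℤ)} (hC : ∀ c ∈ C, S.colsB c = true) {n : ℤ} (hn : 0 ≤ n ∧ n ≤ k)
    (hq : (3 : ℤ) ∣ n - c0 - (q.1 + 2 * q.2)) (hc : Clears 3 Hlo n) (hL : LegFits2 l q F C (dirOfLevel 3 Hlo n) 3)
    (hacc : accB l q (dirOfLevel 3 Hlo n) (βOf k (dirOfLevel 3 Hlo n) n) (S.badG (dirOfLevel 3 Hlo n)) = true) :
    ∀ p ∈ l, p ≠ ((0, 0), 0) → dirOfLevel 3 Hlo n * p.2 ≤ 0 →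
      (0 ≤ n + p.2 ∧ n + p.2 ≤ k) ∧ Adm k (vcol z (q + p.1)) (n + p.2) ∧ vl k (vcol z (q + p.1)) (n + p.2) ∈ WOf S k z := by
  intro p hp hp0 hlow
  obtain ⟨hl, -, -, -, -, hreg⟩ := hL
  obtain ⟨hcq, hlo, -⟩ := hreg p hp hp0
  have hcls : (3 : ℤ) ∣ n + p.2 - c0 - ((q + p.1).1 + 2 * (q + p.1).2) := by
    have h2 := hl.2.2.2.2 p hp; unfold RAdm at h2
    have e : n + p.2 - c0 - ((q + p.1).1 + 2 * (q + p.1).2) = (n - c0 - (q.1 + 2 * q.2)) + (p.2 - (p.1.1 + 2 * p.1.2)) := by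
      simp only [Prod.fst_add, Prod.snd_add]; ring
    rw [e]; exact dvd_add hq h2
  have hd := dirOfLevel_eq 3 Hlo n
  have hm := dir_margin hc
  have hs := βOf_spec (k := k) hd hn.1 hn.2
  have b0 := hs.2.1; have b1 := hs.2.2.1; have b2 := hs.2.2.2
  have hacc' := accB_low hacc hp hp0 hlow
  unfold ShapeB.badG at hacc'
  -- the level `L = n + p.2` is in `[0, k]`; if it is a boundary level the column is not bad there
  have main : (0 ≤ n + p.2 ∧ n + p.2 ≤ k) ∧ (n + p.2 = 0 → S.badBot (q + p.1) = false) ∧ (n + p.2 = k → S.badTop (q + p.1) = false) := by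
    rcases hd with e | e <;> rw [e] at hlow hlo hacc' b0 b1 b2 hm <;> simp only [↓reduceIte, show ¬ ((-1 : ℤ) = 1) by norm_num] at b0 b1 b2 hacc'
    · have h5 := hm.1 rfl
      rcases hacc' with h2 | ⟨h0, hcz⟩
      · have := b2.1 h2; exact ⟨⟨by omega, by omega⟩, fun hb => by omega, fun hb => by omega⟩
      · have hβ := βOf_lt k 1 n
        refine ⟨⟨?_, by omega⟩, fun hb => hcz ?_, fun hb => by omega⟩
        · interval_cases hh : βOf k 1 n
          · have := b0.1 rfl; omega
          · have := b1.1 rfl; omega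
          · have := b2.1 rfl; omega
        · interval_cases hh : βOf k 1 n
          · have := b0.1 rfl; push_cast; omega
          · have := b1.1 rfl; push_cast; omega
          · have := b2.1 rfl; omega
    · have h5 := hm.2 rfl
      rcases hacc' with h2 | ⟨h0, hcz⟩
      · have := b2.1 h2; exact ⟨⟨by omega, by omega⟩, fun hb => by omega, fun hb => by omega⟩
      · have hβ := βOf_lt k (-1) n
        refine ⟨⟨by omega, ?_⟩, fun hb => by omega, fun hb => hcz ?_⟩
        · interval_cases hh : βOf k (-1) n
          · have := b0.1 rfl; omega
          · have := b1.1 rfl; omega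
          · have := b2.1 rfl; omega
        · interval_cases hh : βOf k (-1) n
          · have := b0.1 rfl; push_cast; omega
          · have := b1.1 rfl; push_cast; omega
          · have := b2.1 rfl; omega
  obtain ⟨hrange, hb0, hbk⟩ := main
  exact ⟨hrange, adm_vcol hz hrange.1 hrange.2 hcls, vl_mem_WOf_any hz (hC _ hcq) hrange.1 hrange.2 hb0 hbk hcls⟩

end Slab111

end Summit.CriticalPhenomena.PercolationContinuityZ3.Theorems.Transplant

end
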